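import Mathlib
import Summits.NavierStokesRegularity.NavierStokesRegularity.Theses.L3TimeExponentPincer
import Summits.NavierStokesRegularity.NavierStokesRegularity.Theorems.L3TimeExponentPincerEffNode
import Summits.NavierStokesRegularity.NavierStokesRegularity.Theorems.L3TimeExponentPincerSmoothBranch
import HarnessLib.Audit
import HarnessLib

/-!
# Route `L3TimeExponentPincer` — the PROVED child `JawSmoothBranch` of the split of `L3CascadeJaw`

Item stmt-NavierStokesRegularity-19140 (`Theses.L3TimeExponentPincer.JawSmoothBranch`, support child of the
glued split `L3CascadeJaw ⟸ EffSatBlowup ∧ JawSmoothBranch`, applied 2026-08-26T01:11Z): below a regular time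
`T` (a smooth extension past `T` exists) the frame solution is uniformly bounded on the closed slab (Tao 2013
localisation, tree theorem `tao2011_hasBoundedSobolevNormsOn_holds`), so `‖u(t)‖₃` is bounded near `T` and
`∫_{T₂}^{T} ‖u(t)‖₃^q dt < ∞` for every `q ∈ (4,5)`.  The route decl is a verbatim (definitionally equal) twin of
`Theorems.L3TimeExponentPincerSmoothBranch.JawSmoothBranch`, proved there as `jawSmoothBranch_holds` (p414110);
this file instantiates that theorem at the route's copy.  [cite: Tao2011, Cor. 11.1 + Cor. 4.3 + Thm. 5.4 (iv)]
-/

namespace Summit.NavierStokesRegularity.NavierStokesRegularity.Theorems.L3TimeExponentPincerJawSmoothBranch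

open Summit.NavierStokesRegularity.NavierStokesRegularity.Theorems.L3TimeExponentPincerSmoothBranch

/-- **Item `L3TimeExponentPincer.JawSmoothBranch` (stmt-NavierStokesRegularity-19140) holds**: the jaw on the
smooth branch, by `jawSmoothBranch_holds` (the two decls are definitionally equal). -/
theorem jawSmoothBranch_item :
    Summit.NavierStokesRegularity.NavierStokesRegularity.Theses.L3TimeExponentPincer.JawSmoothBranch :=
  jawSmoothBranch_holds


end Summit.NavierStokesRegularity.NavierStokesRegularity.Theorems.L3TimeExponentPincerJawSmoothBranch
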